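import Summits.QuantumFields.BalabanUV.T4Continuum.Support.NE7QbarTangentCritical
import Summits.QuantumFields.BalabanUV.T4Continuum.Support.NE7MeanZeroGaugeSliceW
import Summits.QuantumFields.BalabanUV.T4Continuum.Support.NE7CornerSpikeTopDictionary
import Summits.QuantumFields.BalabanUV.T4Continuum.Support.NE3CurlPairedResidualScale
import Summits.QuantumFields.BalabanUV.T4Continuum.Support.NE3ProductPathBounds
import Summits.QuantumFields.BalabanUV.T4Continuum.Support.NE3WeightedCoercivityTransfer
import HarnessLib

/-!
# NE7EnergySliceSpikeResidual — (RES♯) ON THE ENERGY BLOCK-LANDAU SLICE `𝒯_E(W)`: the curl-paired dual residual of the block-averaged finer minimiser (row NE3's KERNEL theorem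
# `NE3CurlPairedResidualScale.curlPairedResidual_regular_residualScale`, stated for TANGENT directions) transferred to the directions of `𝒯_E(W)` (double-bar kernel, NOT tangent) by the
# corner SPIKE of `NE7QbarTangentCritical`: `|dAction W Y| ≤ r·(‖Y‖_w + ‖S‖_w)`, with the spike's weighted energy `‖S‖_w² ≤ (4x²·#Plane + 4d∕M²)·N^d·sup‖framePotW Y‖²`

Cell `pub-balaban`, rung (B)+1 sub-cell t4, lineage `b2b-balaban-t4-ne7-p1`, generation 105 (CRUX PROVER NE7 #1 = OWNER of BINDER row NE7).  Memo `t4/b2b-balaban-t4-ne7-p1-g105/ROAD-G105.md` §2.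
WHY.  Node NE3's re-typed root T-E_w♯ (`NE3EnergyWeightedSupShape.NE3EnergyRateWSup`, this generation's assembly `NE7EnergyRateWSU2`) bounds the weighted energy of the slice coordinate `X` between a
level-`k` minimiser and the block average `W = cavg U_B` of a level-`(k+1)` minimiser by the first variation of the Wilson action at `W` along the slice part `X_T ∈ 𝒯_E(W)`.  Row NE3's (RES♯)
(`|dAction W Y| ≤ r·‖Y‖_w`, `r = C′·residualScale`) is a KERNEL theorem for TANGENT directions (`TangentIter`); an element `Y` of `𝒯_E(W)` is tangent only up to the top-corner spike
`S := gaugeDir W (spikeW M (framePotW Y))` (`NE7QbarTangentCritical.tangentIter_sub_spike`), along which `dAction W` vanishes EXACTLY by gauge invariance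
(`NE3PureGaugeFirstVariation.dAction_add_gaugeDir`).  So `|dAction W Y| = |dAction W (Y − S)| ≤ r·‖Y − S‖_w ≤ r·(‖Y‖_w + ‖S‖_w)`, and `‖S‖_w` is controlled by the corner spike letters of gen 97
(`NE7CornerSpikeTopDictionary.dirSq_gaugeDir_spikeW_le ∕ curlSq_gaugeDir_spikeW_le`) and a SUP bound on the accumulated frame `framePotW Y` (an ADDITIVE term of order `N^{d∕2}·G∕M`).
WHAT ([folklore]; 0 def, 0 sorry; general `d`, `L ≥ 1`).  §1 **`energyNormW_spike_sq_le`** — `‖gaugeDir W (spikeW M f)‖_w² ≤ (4x²·#Plane + 4d·M⁻²)·(N^d·G²)` for `N`-periodic `f` with `‖f z‖ ≤ G`;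
§2 **`spike_tangent_data`** — for `Y ∈ 𝒯_E(W)` (class data at `W`): `Y − S` is skew, `(tower L N (j+1))`-periodic and TANGENT, and `dAction W Y F = dAction W (Y − S) F`;
§3 **`abs_dAction_le_of_regular_slice`** — the transfer: `U_B` a level-`(j+2)` minimiser of `sfClass d L N ε`, `Regular d L N b g (j+2)`, `0 ≤ b < ε`, `0 < g`,
`LevelSmall d L (j+1) (ε∕(L^{j+2})²)`, class data at `W := cavg L U_B` ⟹ for every `Y ∈ 𝒯_E(W)`:
`|dAction W Y (perWin d (N·L^{j+1}))| ≤ C′·residualScale d L N b g (j+1)·(‖Y‖_w + ‖S‖_w)` (`C′` = row NE3's level-free constant of `curlPairedResidual_regular_residualScale`, `d ≥ 2`).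
HONEST FRAMING (page 1): composition of landed kernel theorems (row NE3's (RES♯), gen 97∕99 spike kinematics); nothing of Bałaban's asserted; NOT T-E_w♯ (the assembly is `NE7EnergyRateWSU2`), NOT NE3,
NOT NE7; spine count unchanged; finite T⁴ rung (B)+1 — NOT infinite volume, NOT mass gap, NOT BetaPertH, NOT Clay (continuum YM on T⁴ ⇐ BetaPertH ∧ nine spine estimates).
-/

set_option autoImplicit false

open scoped BigOperators Matrix Matrix.Norms.L2Operator
open NormedSpace Finset

namespace Summit.QuantumFields.BalabanUV.T4Continuum.NE7EnergySliceSpikeResidual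

open Literature.MathematicalPhysics.QuantumFieldTheory.Balaban1983to89
open B7Prop1Explicit B7Prop2Explicit
open T4AveragingDeficitWall (IsUnitaryCfg IsSkewDir SmallField Plaq curlSq dirSq)
open T4AveragingDeficitWallBoundary (IsPeriodicCfg periodBox card_periodBox)
open AveragingDeficitPeriodicCounting (IsPeriodicDir)
open AveragingDeficitMultiLevelPrep (cavgIter LevelSmall tower TangentIter)
open AveragingDeficitChartCalculus (cavg)
open BlockAveragePushDirGauge (gaugeDir isPeriodicDir_gaugeDir)
open NE3TangentCovariantTower (QbarIter framePotW)
open NE3CornerSpikes (spikeW spikeW_mem_skewAdjoint spikeW_add_period)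
open NE7CornerSpikeTopDictionary (natCast_tower_eq_pow_mul dirSq_gaugeDir_spikeW_le curlSq_gaugeDir_spikeW_le)
open NE3LandauOrbit (gaugeDir_skew)
open NE3CurvedFrameKill (framePotW_skew_periodic)
open NE3HessForm (dAction)
open NE3PureGaugeFirstVariation (dAction_add_gaugeDir)
open NE7QbarTangentCritical (gaugeDir_zero_fun' sub_add_dir' tangentIter_sub_spike)
open NE7MeanZeroGaugeSliceW (energyBlockLandauW)
open NE3EnergyShapes (residualScale residualScale_nonneg)
open NE3EnergyWeightedShapes (energyNormW energyNormW_nonneg CurlPairedResidual)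
open NE3WeightedCoercivityTransfer (energyNormW_sq)
open NE3ProductPathBounds (energyNormW_sub_le)
open NE3CurlPairedResidualScale (curlPairedResidual_regular_residualScale)
open MinimalActionLevels (perWin)
open MinimalActionSandwich (IsMinimiser)
open MinimalActionRate (sfClass Regular)
open NE3EnergyRateWSupOfSlicePoincare (tower_eq_mul_pow)

noncomputable section

variable {d : ℕ} {n : Type*} [Fintype n] [DecidableEq n]

/-! ## §1 The weighted energy of a corner spike -/

/-- **THE WEIGHTED ENERGY OF A CORNER SPIKE** (`M, N ≥ 1`, `W` unitary with `SmallField W x`, `f` skew-irrelevant, `N`-periodic with `‖f z‖ ≤ G`):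
`‖gaugeDir W (spikeW M f)‖_w² ≤ (4x²·#Plane + 4d·M⁻²)·(N^d·G²)` over the period box of side `N·M` (weight `M⁻²` on the bond term, as in `energyNormW L (j+1)` with `M = L^{j+1}`). [folklore] -/
theorem energyNormW_spike_sq_le [Nonempty n] {L N : ℕ} (hL : 1 ≤ L) (hN : 1 ≤ N) (j : ℕ) {W : Site d → Fin d → (Matrix n n ℂ)ˣ} (hWu : IsUnitaryCfg W)
    {x : ℝ} (hWx : SmallField W x) {f : Site d → Matrix n n ℂ} (hfP : ∀ (z : Site d) (τ : Fin d), f (z + (N : ℤ) • e τ) = f z)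
    {G : ℝ} (hfG : ∀ z, ‖f z‖ ≤ G) :
    energyNormW L (j + 1) W (gaugeDir W (spikeW (L ^ (j + 1)) f)) (periodBox (d := d) (N * L ^ (j + 1))) ^ 2
      ≤ (4 * x ^ 2 * (Fintype.card (T4AveragingDeficitWall.Plane d)) + 4 * (d : ℝ) * (((L : ℝ) ^ (j + 1))⁻¹) ^ 2)
          * ((N : ℝ) ^ d * G ^ 2) := by
  have hM : 1 ≤ L ^ (j + 1) := Nat.one_le_pow _ L (by omega)
  have hsum : ∑ z ∈ periodBox (d := d) N, ‖f z‖ ^ 2 ≤ (N : ℝ) ^ d * G ^ 2 := by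
    calc ∑ z ∈ periodBox (d := d) N, ‖f z‖ ^ 2 ≤ ∑ _z ∈ periodBox (d := d) N, G ^ 2 :=
          Finset.sum_le_sum fun z _ => pow_le_pow_left₀ (norm_nonneg _) (hfG z) 2
      _ = (N : ℝ) ^ d * G ^ 2 := by rw [Finset.sum_const, card_periodBox, nsmul_eq_mul]; push_cast; ring
  have hNM : N * L ^ (j + 1) = L ^ (j + 1) * N := Nat.mul_comm _ _
  have hD := dirSq_gaugeDir_spikeW_le (d := d) hM hN hWu hfP (h := f)
  have hC := curlSq_gaugeDir_spikeW_le (d := d) hM N hWu hWx f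
  rw [← hNM] at hD hC
  rw [energyNormW_sq]
  have hw0 : 0 ≤ (((L : ℝ) ^ (j + 1))⁻¹) ^ 2 := sq_nonneg _
  have hP0 : (0 : ℝ) ≤ Fintype.card (T4AveragingDeficitWall.Plane d) := Nat.cast_nonneg _
  have hd0 : (0 : ℝ) ≤ d := Nat.cast_nonneg _
  have hS0 : 0 ≤ ∑ z ∈ periodBox (d := d) N, ‖f z‖ ^ 2 := Finset.sum_nonneg fun _ _ => sq_nonneg _
  have h1 : curlSq W (gaugeDir W (spikeW (L ^ (j + 1)) f)) (periodBox (d := d) (N * L ^ (j + 1)))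
      ≤ 4 * x ^ 2 * (Fintype.card (T4AveragingDeficitWall.Plane d)) * ((N : ℝ) ^ d * G ^ 2) :=
    hC.trans (mul_le_mul_of_nonneg_left hsum (by positivity))
  have h2 : (((L : ℝ) ^ (j + 1))⁻¹) ^ 2 * dirSq (gaugeDir W (spikeW (L ^ (j + 1)) f)) (periodBox (d := d) (N * L ^ (j + 1)))
      ≤ (((L : ℝ) ^ (j + 1))⁻¹) ^ 2 * (4 * (d : ℝ) * ((N : ℝ) ^ d * G ^ 2)) :=
    mul_le_mul_of_nonneg_left (hD.trans (mul_le_mul_of_nonneg_left hsum (by positivity))) hw0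
  linarith

/-! ## §2 The spike-corrected direction of a slice element is tangent, and carries the same first variation -/

/-- **SPIKE CORRECTION OF A SLICE ELEMENT** (class data at the level-`(j+1)` background `W`, `L ≥ 1`): for `Y ∈ 𝒯_E(W)` and `S := gaugeDir W (spikeW L^{j+1} (framePotW L (j+1) W Y))`,
the direction `Y − S` is skew, `(tower L N (j+1))`-periodic and TANGENT (`TangentIter L j W`), and `dAction W Y F = dAction W (Y − S) F` on every window. [folklore] -/
theorem spike_tangent_data [Nonempty n] {L N : ℕ} [NeZero N] (hL : 1 ≤ L) (j : ℕ) {W : Site d → Fin d → (Matrix n n ℂ)ˣ} {x : ℝ}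
    (hWu : IsUnitaryCfg W) (hWP : IsPeriodicCfg W ((tower L N (j + 1) : ℕ) : ℤ)) (hx : 0 ≤ x) (hs : LevelSmall d L j x) (hWx : SmallField W x)
    {Y : Site d → Fin d → Matrix n n ℂ} (hY : Y ∈ energyBlockLandauW (d := d) (n := n) L N (j + 1) W) :
    IsSkewDir (fun y μ => Y y μ - gaugeDir W (spikeW (L ^ (j + 1)) (framePotW L (j + 1) W Y)) y μ) ∧
    IsPeriodicDir (fun y μ => Y y μ - gaugeDir W (spikeW (L ^ (j + 1)) (framePotW L (j + 1) W Y)) y μ) ((tower L N (j + 1) : ℕ) : ℤ) ∧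
    TangentIter L j W (fun y μ => Y y μ - gaugeDir W (spikeW (L ^ (j + 1)) (framePotW L (j + 1) W Y)) y μ) ∧
    (∀ (z : Site d) (τ : Fin d), framePotW L (j + 1) W Y (z + (N : ℤ) • e τ) = framePotW L (j + 1) W Y z) ∧
    ∀ F : Finset (Plaq d), dAction W Y F = dAction W (fun y μ => Y y μ - gaugeDir W (spikeW (L ^ (j + 1)) (framePotW L (j + 1) W Y)) y μ) F := by
  obtain ⟨hYs, hYP, hYQ, -⟩ := hY
  have hM : 1 ≤ L ^ (j + 1) := Nat.one_le_pow _ L (by omega)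
  obtain ⟨hfs, hfP⟩ := framePotW_skew_periodic (M := N) hL j hWu hWP hx hs hWx hYs hYP
  -- the spike generator is skew and `(tower L N (j+1))`-periodic
  have hσs : ∀ y, spikeW (L ^ (j + 1)) (framePotW L (j + 1) W Y) y ∈ skewAdjoint (Matrix n n ℂ) := spikeW_mem_skewAdjoint _ hfs
  have hσP : ∀ (y : Site d) (i : Fin d), spikeW (L ^ (j + 1)) (framePotW L (j + 1) W Y) (y + ((tower L N (j + 1) : ℕ) : ℤ) • e i)
      = spikeW (L ^ (j + 1)) (framePotW L (j + 1) W Y) y := by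
    intro y i; rw [natCast_tower_eq_pow_mul]; exact spikeW_add_period hM hfP y i
  have hTs : IsSkewDir (fun y μ => Y y μ - gaugeDir W (spikeW (L ^ (j + 1)) (framePotW L (j + 1) W Y)) y μ) :=
    fun y μ => (skewAdjoint _).sub_mem (hYs y μ) (gaugeDir_skew hWu hσs y μ)
  have hTP : IsPeriodicDir (fun y μ => Y y μ - gaugeDir W (spikeW (L ^ (j + 1)) (framePotW L (j + 1) W Y)) y μ) ((tower L N (j + 1) : ℕ) : ℤ) := by
    intro y i μ
    have h1 := hYP y i μ
    have h2 := isPeriodicDir_gaugeDir hWP hσP y i μ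
    simp only
    rw [h1, h2]
  -- tangency: `QbarIter Y = 0 = gaugeDir (cavgIter) 0`, so the spike heights are `0 + framePotW Y`
  have hQ' : QbarIter L (j + 1) W Y = gaugeDir (cavgIter L (j + 1) W) (fun _ => (0 : Matrix n n ℂ)) := by
    rw [hYQ, gaugeDir_zero_fun']; rfl
  have hTt0 := tangentIter_sub_spike hL j hWu hWP hx hs hWx hYs hYP (h := fun _ => (0 : Matrix n n ℂ))
    (fun _ => (skewAdjoint _).zero_mem) (fun _ _ => rfl) hQ'
  have hTt : TangentIter L j W (fun y μ => Y y μ - gaugeDir W (spikeW (L ^ (j + 1)) (framePotW L (j + 1) W Y)) y μ) := by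
    simpa only [zero_add] using hTt0
  refine ⟨hTs, hTP, hTt, hfP, fun F => ?_⟩
  have hadd := dAction_add_gaugeDir W (fun y μ => Y y μ - gaugeDir W (spikeW (L ^ (j + 1)) (framePotW L (j + 1) W Y)) y μ)
    (spikeW (L ^ (j + 1)) (framePotW L (j + 1) W Y)) F
  rw [sub_add_dir' Y (gaugeDir W (spikeW (L ^ (j + 1)) (framePotW L (j + 1) W Y)))] at hadd
  exact hadd

/-! ## §3 (RES♯) transferred to the slice `𝒯_E(cavg U_B)` -/

/-- **(RES♯) ON `𝒯_E(W)` AT THE BLOCK AVERAGE OF A REGULAR FINER MINIMISER** (`d ≥ 2`, `L, N ≥ 1`): `U_B` a minimiser of `sfClass d L N ε` at level `j+2` with datum `V`,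
`Regular d L N b g (j+2) U_B`, `0 ≤ b < ε`, `0 < g`, `LevelSmall d L (j+1) (ε∕(L^{j+2})²)`; `W := cavg L U_B` with class data (unitary, `(tower L N (j+1))`-periodic, `LevelSmall d L j x`,
`SmallField W x`).  Then for every `Y ∈ 𝒯_E(W)`, with `S := gaugeDir W (spikeW L^{j+1} (framePotW L (j+1) W Y))` and `r := C′·residualScale d L N b g (j+1)` (row NE3's (RES♯) constant):
`|dAction W Y (perWin d (N·L^{j+1}))| ≤ r·(‖Y‖_w + ‖S‖_w)` over the period box of side `N·L^{j+1}`. [folklore] -/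
theorem abs_dAction_le_of_regular_slice [Nonempty n] (hd : 2 ≤ d) {L N : ℕ} [NeZero L] [NeZero N] (hL : 1 ≤ L) (hN : 1 ≤ N) (j : ℕ)
    {ε b g : ℝ} (hb : 0 ≤ b) (hbε : b < ε) (hg : 0 < g)
    (hsmall : LevelSmall d L (j + 1) (ε / ((L : ℝ) ^ (j + 2)) ^ 2))
    {V UB : Site d → Fin d → (Matrix n n ℂ)ˣ} (hB : IsMinimiser d (sfClass d L N ε) L N (j + 2) V UB)
    (hreg : Regular d L N b g (j + 2) UB) {x : ℝ}
    (hWu : IsUnitaryCfg (cavg L UB)) (hWP : IsPeriodicCfg (cavg L UB) ((tower L N (j + 1) : ℕ) : ℤ)) (hx : 0 ≤ x) (hs : LevelSmall d L j x)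
    (hWx : SmallField (cavg L UB) x)
    {Y : Site d → Fin d → Matrix n n ℂ} (hY : Y ∈ energyBlockLandauW (d := d) (n := n) L N (j + 1) (cavg L UB)) :
    |dAction (cavg L UB) Y (perWin d (N * L ^ (j + 1)))|
      ≤ ((Real.sqrt ((L : ℝ) ^ (d - 2))
            + (Real.sqrt ((L : ℝ) ^ (d - 2)) * Real.sqrt (8 * Fintype.card (T4AveragingDeficitWall.Plane d))
                * (128 * (d * (L : ℝ) ^ 2))
              + 2 * (2048 * ((d : ℝ) + 4) ^ 2 * (L : ℝ) ^ 2 * Real.sqrt (d * (L : ℝ) ^ d))) * b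
            + b ^ 2 * (2 * (L : ℝ) ^ (d - 1) + 2 * (8 * d * (L : ℝ) ^ d)) * Real.sqrt (d / (g * (L : ℝ) ^ (d + 2))))
          * residualScale d L N b g (j + 1))
        * (energyNormW L (j + 1) (cavg L UB) Y (periodBox (d := d) (N * L ^ (j + 1)))
            + energyNormW L (j + 1) (cavg L UB) (gaugeDir (cavg L UB) (spikeW (L ^ (j + 1)) (framePotW L (j + 1) (cavg L UB) Y)))
                (periodBox (d := d) (N * L ^ (j + 1)))) := by
  set W := cavg L UB with hW
  set S : Site d → Fin d → Matrix n n ℂ := gaugeDir W (spikeW (L ^ (j + 1)) (framePotW L (j + 1) W Y)) with hSdef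
  obtain ⟨hTs, hTP, hTt, -, hdA⟩ := spike_tangent_data (N := N) hL j hWu hWP hx hs hWx hY
  have htow : ((tower L N (j + 1) : ℕ) : ℤ) = ((N * L ^ (j + 1) : ℕ) : ℤ) := by rw [tower_eq_mul_pow]
  rw [htow] at hTP
  -- (RES♯) on the singleton `{Y − S}`
  have hres := curlPairedResidual_regular_residualScale (n := n) hd hL hN j hb hbε hg hsmall hB hreg
    (T := {Z | Z = fun y μ => Y y μ - S y μ})
    (fun Z hZ => by rw [Set.mem_setOf_eq] at hZ; subst hZ; exact ⟨hTs, hTP, hTt⟩)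
  have h1 := hres (fun y μ => Y y μ - S y μ) (by rw [Set.mem_setOf_eq])
  -- `dAction W Y = dAction W (Y − S)` and `‖Y − S‖_w ≤ ‖Y‖_w + ‖S‖_w`
  have hsub : (fun y μ => Y y μ - S y μ) = Y - S := by funext y μ; rfl
  have htri := energyNormW_sub_le L (j + 1) W Y S (periodBox (d := d) (N * L ^ (j + 1)))
  rw [← hsub] at htri
  have hr0 : 0 ≤ (Real.sqrt ((L : ℝ) ^ (d - 2))
            + (Real.sqrt ((L : ℝ) ^ (d - 2)) * Real.sqrt (8 * Fintype.card (T4AveragingDeficitWall.Plane d))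
                * (128 * (d * (L : ℝ) ^ 2))
              + 2 * (2048 * ((d : ℝ) + 4) ^ 2 * (L : ℝ) ^ 2 * Real.sqrt (d * (L : ℝ) ^ d))) * b
            + b ^ 2 * (2 * (L : ℝ) ^ (d - 1) + 2 * (8 * d * (L : ℝ) ^ d)) * Real.sqrt (d / (g * (L : ℝ) ^ (d + 2))))
          * residualScale d L N b g (j + 1) := mul_nonneg (by positivity) (residualScale_nonneg d L N b g (j + 1))
  rw [hdA (perWin d (N * L ^ (j + 1)))]
  exact h1.trans (mul_le_mul_of_nonneg_left htri hr0)

end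

end Summit.QuantumFields.BalabanUV.T4Continuum.NE7EnergySliceSpikeResidual
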